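import Summits.KontsevichZagierPeriods.Zeta5Search.WedgeDictionaryLevelDescentVFullDescent
import HarnessLib

/-!
# Level descent for `VFull` — the slot-exchange identity `ldY_swap12_stmt` (PROVED)

HONEST FRAMING: "systematic search; no irrationality claim unless certified".

`…VFullDescent` reduced (T3) = `ldSE_rowSource_stmt` to two identities of the boundary sum `SE` alone: REL-(3) for
`Y(b) = (d+1)·SE(b) − Π₂·SE(b−e₂)` along slot 1 (`ldY_rel3_stmt`) and the slot-exchange identity
`Y(b⁽¹²⁾)·η(b−e₂) = η(b⁽¹²⁾−e₂)·Y(b)` (`ldY_swap12_stmt`). This file PROVES the second one (`ldY_swap12_holds`):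

* `ldSE_cross12` — the `(1,2)` cross relation `(b₁−b₂)(c₁₂+1)(d+1)·SE(b) = b₁(N+1−b₁)Π₂(b⁽¹²⁾)·SE(b−e₁) − b₂(N+1−b₂)Π₂(b)·SE(b−e₂)`
  on rows (`b₇ = 0`, `b₁, b₂ ≥ 1`): it is the tree's PROVED `(2,7)` cross relation `ldSE_crossRel` at the `1 ↔ 7` exchanged shape,
  transported by the `{1,2,7}`-symmetry `ldSE_swap` (no new weight-level work);
* `rowEta_swap12`, `rowEta_lowerSlot1`, `rowEta_lowerSlot2` — `η` is `1 ↔ 2` symmetric and `η(b) = b_t(N+1−b_t)·η(b−e_t)` (`t = 1, 2`);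
* `ldY_swap12_holds` — dividing by `η`, the claim is `b₁(N+1−b₁)·Y(b⁽¹²⁾) = b₂(N+1−b₂)·Y(b)`, i.e. `ldSE_cross12`.

Consequently (§S5) **(T3) ⇐ `ldY_rel3_stmt` alone** (`ldSE_rowSource_of_rel3`), and `levelDescentVFull ⇐ ldY_rel3_stmt`
(`levelDescentVFull_of_rel3`). REL-(3) for `Y` is the exactrec engine's certificate (eng-exactrec-1, zeta5ct-0.1); its transcription is the
remaining work.
-/

open Finset Polynomial

namespace Summit.KontsevichZagierPeriods.Zeta5Search.WedgeDictionary

open Summit.KontsevichZagierPeriods.Zeta5Search.DualSeries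
open Literature.NumberTheory.Transcendental

/-! ### §S1 Slot bookkeeping: `lowerSlot`, `swap12`, `swap17` -/

/-- Values of `b − e_k`. -/
theorem lowerSlot_apply (b : ℕ → ℤ) (k i : ℕ) : lowerSlot b k i = if i = k then b k - 1 else b i := by
  simp only [lowerSlot, Function.update_apply]

/-- `b` with the slots `1` and `7` exchanged. -/
def swap17 (b : ℕ → ℤ) : ℕ → ℤ := fun i => b (Equiv.swap 1 7 i)

/-- Values of `b⁽¹⁷⁾`. -/
theorem swap17_apply (b : ℕ → ℤ) (i : ℕ) : swap17 b i = if i = 1 then b 7 else if i = 7 then b 1 else b i := by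
  simp only [swap17, Equiv.swap_apply_def]
  split_ifs <;> rfl

/-- `b⁽¹⁷⁾₀ = b₀`. -/
theorem swap17_zero (b : ℕ → ℤ) : swap17 b 0 = b 0 := by
  simp [swap17_apply]

/-- `d(b⁽¹⁷⁾) = d(b)`. -/
theorem dOf_swap17 (b : ℕ → ℤ) : dOf (swap17 b) = dOf b :=
  dOf_swap b (show 1 ∈ ({1, 2, 7} : Finset ℕ) by simp) (show 7 ∈ ({1, 2, 7} : Finset ℕ) by simp)

/-- `SE(b⁽¹⁷⁾) = SE(b)` (tree: `ldSE_swap`). -/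
theorem ldSE_swap17 (b : ℕ → ℤ) : ldSE (swap17 b) = ldSE b :=
  ldSE_swap b (show 1 ∈ ({1, 2, 7} : Finset ℕ) by simp) (show 7 ∈ ({1, 2, 7} : Finset ℕ) by simp)

/-- `SE(b⁽¹²⁾) = SE(b)` (tree: `ldSE_swap`). -/
theorem ldSE_swap12 (b : ℕ → ℤ) : ldSE (swap12 b) = ldSE b :=
  ldSE_swap b (show 1 ∈ ({1, 2, 7} : Finset ℕ) by simp) (show 2 ∈ ({1, 2, 7} : Finset ℕ) by simp)

/-- `b⁽¹⁷⁾ − e₂ = (b − e₂)⁽¹⁷⁾`. -/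
theorem lowerSlot2_swap17 (b : ℕ → ℤ) : lowerSlot (swap17 b) 2 = swap17 (lowerSlot b 2) := by
  funext i
  by_cases h1 : i = 1
  · subst h1; simp [lowerSlot_apply, swap17_apply]
  by_cases h2 : i = 2
  · subst h2; simp [lowerSlot_apply, swap17_apply]
  by_cases h7 : i = 7
  · subst h7; simp [lowerSlot_apply, swap17_apply]
  simp [lowerSlot_apply, swap17_apply, h1, h2, h7]

/-- `b⁽¹⁷⁾ − e₇ = (b − e₁)⁽¹⁷⁾`. -/
theorem lowerSlot7_swap17 (b : ℕ → ℤ) : lowerSlot (swap17 b) 7 = swap17 (lowerSlot b 1) := by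
  funext i
  by_cases h1 : i = 1
  · subst h1; simp [lowerSlot_apply, swap17_apply]
  by_cases h7 : i = 7
  · subst h7; simp [lowerSlot_apply, swap17_apply]
  simp [lowerSlot_apply, swap17_apply, h1, h7]

/-- `b⁽¹²⁾ − e₂ = (b − e₁)⁽¹²⁾`. -/
theorem lowerSlot2_swap12 (b : ℕ → ℤ) : lowerSlot (swap12 b) 2 = swap12 (lowerSlot b 1) := by
  funext i
  by_cases h1 : i = 1
  · subst h1; simp [lowerSlot_apply, swap12_apply]
  by_cases h2 : i = 2
  · subst h2; simp [lowerSlot_apply, swap12_apply]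
  simp [lowerSlot_apply, swap12_apply, h1, h2]

/-- `b⁽¹²⁾ − e₁ = (b − e₂)⁽¹²⁾`. -/
theorem lowerSlot1_swap12 (b : ℕ → ℤ) : lowerSlot (swap12 b) 1 = swap12 (lowerSlot b 2) := by
  funext i
  by_cases h1 : i = 1
  · subst h1; simp [lowerSlot_apply, swap12_apply]
  by_cases h2 : i = 2
  · subst h2; simp [lowerSlot_apply, swap12_apply]
  simp [lowerSlot_apply, swap12_apply, h1, h2]

/-- `(b − e₁) + e₁ = b`. -/
theorem update_lowerSlot1 (b : ℕ → ℤ) : Function.update (lowerSlot b 1) 1 (lowerSlot b 1 1 + 1) = b := by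
  funext i
  simp only [Function.update_apply, lowerSlot_apply, if_true]
  split_ifs with h
  · rw [h]; ring
  · rfl

/-! ### §S2 The `(1,2)` cross relation of the boundary sum, from the proved `(2,7)` one by the `{1,2,7}`-symmetry -/

/-- **The `(1,2)` cross relation of `SE`** on rows (`b₇ = 0`, `b₁, b₂ ≥ 1`):
`(b₁−b₂)(c₁₂+1)(d+1)·SE(b) = b₁(N+1−b₁)·Π₂(b⁽¹²⁾)·SE(b−e₁) − b₂(N+1−b₂)·Π₂(b)·SE(b−e₂)` — the tree's `(2,7)` relation `ldSE_crossRel`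
at the `1 ↔ 7` exchanged shape (there `b₇ ↦ b₁ ≥ 1`, `b₁ ↦ b₇ = 0`), transported back by `ldSE_swap`. -/
theorem ldSE_cross12 (b : ℕ → ℤ) (h0 : 0 ≤ b 0) (hbox : ∀ j ∈ Icc 1 7, 0 ≤ b j ∧ b j ≤ b 0)
    (hB : ∀ j ∈ Icc 3 6, 2 * b j ≤ b 0) (hd : 0 ≤ dOf b) (hb1 : 1 ≤ b 1) (hb2 : 1 ≤ b 2) (hb7 : b 7 = 0) :
    ((b 1 : ℚ) - b 2) * (((b 0 : ℚ) - b 1 - b 2) + 1) * ((dOf b : ℚ) + 1) * ldSE b =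
      (b 1 : ℚ) * ((b 0 : ℚ) + 1 - b 1) * mixedPi2 (swap12 b) * ldSE (lowerSlot b 1) -
        (b 2 : ℚ) * ((b 0 : ℚ) + 1 - b 2) * mixedPi2 b * ldSE (lowerSlot b 2) := by
  have hbox' : ∀ j ∈ Icc 1 7, 0 ≤ swap17 b j ∧ swap17 b j ≤ swap17 b 0 := by
    intro j hj
    rw [swap17_zero, swap17_apply]
    split_ifs
    · exact hbox 7 (by simp)
    · exact hbox 1 (by simp)
    · exact hbox j hj
  have hB' : ∀ j ∈ Icc 3 6, 2 * swap17 b j ≤ swap17 b 0 := by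
    intro j hj
    simp only [mem_Icc] at hj
    rw [swap17_zero, swap17_apply, if_neg (by omega), if_neg (by omega)]
    exact hB j (by simp only [mem_Icc]; omega)
  have h := ldSE_crossRel (swap17 b) (by rw [swap17_zero]; exact h0) hbox' hB' (by rw [dOf_swap17]; exact hd)
    (by rw [swap17_apply]; simpa using hb2) (by rw [swap17_apply]; simpa using hb1)
  unfold CrossRel at h
  rw [dOf_swap17, ldSE_swap17, lowerSlot2_swap17, lowerSlot7_swap17, ldSE_swap17, ldSE_swap17] at h
  simp only [mixedPi2, mixedPi7, prod_insert, mem_insert, mem_singleton, prod_singleton, Nat.reduceEqDiff, or_self,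
    not_false_eq_true, swap17_apply, swap12_apply, if_true, if_false, hb7] at h ⊢
  push_cast at h ⊢
  linear_combination (-(((b 0 : ℚ) - b 1 - b 2) + 1)) * h

/-! ### §S3 `η` under the slot exchange and under lowering a slot -/

/-- `η(b⁽¹²⁾) = η(b)`. -/
theorem rowEta_swap12 (b : ℕ → ℤ) : rowEta (swap12 b) = rowEta b := by
  unfold rowEta hPoly
  simp only [prod_range_succ, prod_range_zero, one_mul, Nat.reduceAdd, swap12_apply, Nat.reduceEqDiff, if_true, if_false]
  ring

/-- `η(b) = b₁(N+1−b₁)·η(b − e₁)` (`b` a row with `b₁ ≥ 1`). -/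
theorem rowEta_lowerSlot1 (b : ℕ → ℤ) (h0 : 0 ≤ b 0) (hbox : ∀ j ∈ Icc 1 7, 0 ≤ b j ∧ b j ≤ b 0) (hb1 : 1 ≤ b 1) :
    rowEta b = (b 1 : ℚ) * ((b 0 : ℚ) + 1 - b 1) * rowEta (lowerSlot b 1) := by
  have hIn : InBox (lowerSlot b 1) := by
    rw [inBox_iff]
    simp only [lowerSlot_apply, mem_Icc, Nat.reduceEqDiff, if_true, if_false] at hbox ⊢
    have := hbox 1; have := hbox 2; have := hbox 3; have := hbox 4; have := hbox 5; have := hbox 6; have := hbox 7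
    norm_num
    omega
  have hle : ∀ j ∈ range 7, lowerSlot b 1 (j + 1) ≤ lowerSlot b 1 0 := by
    intro j hj
    simp only [mem_range] at hj
    have := hbox (j + 1) (by simp only [mem_Icc]; omega)
    rw [lowerSlot_apply, lowerSlot_apply, if_neg (show (0 : ℕ) ≠ 1 by decide)]
    split_ifs with h
    · rw [h] at this; omega
    · exact this.2
  have h := rowEta_bump1 (lowerSlot b 1) hIn hle
    (by have := (hbox 1 (by simp)).2; simp only [lowerSlot_apply]; norm_num; omega)
  rw [update_lowerSlot1] at h
  rw [h]
  simp only [lowerSlot_apply, Nat.reduceEqDiff, if_true, if_false]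
  push_cast
  ring

/-- `η(b) = b₂(N+1−b₂)·η(b − e₂)` (`b` a row with `b₂ ≥ 1`), by the slot exchange. -/
theorem rowEta_lowerSlot2 (b : ℕ → ℤ) (h0 : 0 ≤ b 0) (hbox : ∀ j ∈ Icc 1 7, 0 ≤ b j ∧ b j ≤ b 0) (hb2 : 1 ≤ b 2) :
    rowEta b = (b 2 : ℚ) * ((b 0 : ℚ) + 1 - b 2) * rowEta (lowerSlot b 2) := by
  have hbox' : ∀ j ∈ Icc 1 7, 0 ≤ swap12 b j ∧ swap12 b j ≤ swap12 b 0 := by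
    intro j hj
    rw [swap12_zero, swap12_apply]
    split_ifs
    · exact hbox 2 (by simp)
    · exact hbox 1 (by simp)
    · exact hbox j hj
  have h := rowEta_lowerSlot1 (swap12 b) (by rw [swap12_zero]; exact h0) hbox' (by rw [swap12_apply]; simpa using hb2)
  rw [rowEta_swap12, lowerSlot1_swap12, rowEta_swap12, swap12_zero, swap12_apply, if_pos rfl] at h
  exact h

/-! ### §S4 The slot-exchange identity for `Y` -/

/-- **`ldY_swap12_stmt` holds**: `Y(b⁽¹²⁾)·η(b−e₂) = η(b⁽¹²⁾−e₂)·Y(b)` — by `η(b) = b₁(N+1−b₁)η(b−e₁) = b₂(N+1−b₂)η(b−e₂)` it is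
`b₁(N+1−b₁)·Y(b⁽¹²⁾) = b₂(N+1−b₂)·Y(b)`, which is the `(1,2)` cross relation `ldSE_cross12`. -/
theorem ldY_swap12_holds : ldY_swap12_stmt := by
  intro b h0 hbox hB hd hb1 hb2 hb7 _hc
  obtain ⟨hIn, hle⟩ := inBox_of_rowBox b h0 hbox
  have hX := ldSE_cross12 b h0 hbox hB hd hb1 hb2 hb7
  have hE1 := rowEta_lowerSlot1 b h0 hbox hb1
  have hE2 := rowEta_lowerSlot2 b h0 hbox hb2
  have hb1N := (hbox 1 (by simp)).2
  have hb2N := (hbox 2 (by simp)).2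
  have hr : ((b 1 : ℚ) * ((b 0 : ℚ) + 1 - b 1)) * ((b 2 : ℚ) * ((b 0 : ℚ) + 1 - b 2)) ≠ 0 := by
    have : (0 : ℤ) < (b 1 * (b 0 + 1 - b 1)) * (b 2 * (b 0 + 1 - b 2)) :=
      mul_pos (mul_pos (by omega) (by omega)) (mul_pos (by omega) (by omega))
    have : (0 : ℚ) < ((b 1 : ℚ) * ((b 0 : ℚ) + 1 - b 1)) * ((b 2 : ℚ) * ((b 0 : ℚ) + 1 - b 2)) := by exact_mod_cast this
    exact this.ne'
  unfold ldY
  rw [ldSE_swap12, dOf_swap12, lowerSlot2_swap12, ldSE_swap12, rowEta_swap12]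
  have key : ((b 1 : ℚ) * ((b 0 : ℚ) + 1 - b 1)) * ((b 2 : ℚ) * ((b 0 : ℚ) + 1 - b 2)) *
      ((((dOf b : ℚ) + 1) * ldSE b - mixedPi2 (swap12 b) * ldSE (lowerSlot b 1)) * rowEta (lowerSlot b 2) -
        rowEta (lowerSlot b 1) * (((dOf b : ℚ) + 1) * ldSE b - mixedPi2 b * ldSE (lowerSlot b 2))) = 0 := by
    linear_combination (-((b 1 : ℚ) * ((b 0 : ℚ) + 1 - b 1)) *
        (((dOf b : ℚ) + 1) * ldSE b - mixedPi2 (swap12 b) * ldSE (lowerSlot b 1))) * hE2 +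
      (((b 2 : ℚ) * ((b 0 : ℚ) + 1 - b 2)) * (((dOf b : ℚ) + 1) * ldSE b - mixedPi2 b * ldSE (lowerSlot b 2))) * hE1 +
      rowEta b * hX
  have := (mul_eq_zero.1 key).resolve_left hr
  linear_combination this

/-! ### §S5 Consequence: (T3) and `levelDescentVFull` from REL-(3) for `Y` alone -/

/-- **(T3) ⇐ REL-(3) for `Y`**: with the slot-exchange identity proved, `ldSE_rowSource_stmt` follows from `ldY_rel3_stmt` alone. -/
theorem ldSE_rowSource_of_rel3 (hR : ldY_rel3_stmt) : ldSE_rowSource_stmt :=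
  ldSE_rowSource_of_descent hR ldY_swap12_holds

/-- **`levelDescentVFull` ⇐ REL-(3) for `Y`.** -/
theorem levelDescentVFull_of_rel3 (hR : ldY_rel3_stmt) : levelDescentVFull :=
  levelDescentVFull_of_descent hR ldY_swap12_holds

end Summit.KontsevichZagierPeriods.Zeta5Search.WedgeDictionary
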